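/-
Copyright (c) 2026 the pub-hodgecm-mathlib formalisation cell (harness21).  Prover seat hodgecm-mathlib-K2E5-p10 (g2),
Track B «K2-LIT» ∕ h413 (stmt-HodgeConjecture-24833), engine E5 «TamagawaUnitary», unit G organ (O6) FILE A′ (defs):
the arch × fin splitting of the base torus is COMPATIBLE WITH THE REDUCED NORM `Nrd = (Nrd_∞, Nrd_f)` of `D_h`, and the image torus splits:
`Nrd((D_h ⊗ 𝔸)^×) ≃ₜ* (Π_w Nrd_w(D_{h,w}^×)) × (𝔸_{L⁺,f})^×`.  2026-09-04.
-/
import Summits.HodgeConjecture.HodgeConjecture.Theorems.K2E5FixedIdeleBaseSplitting      -- ★ (O6) FILE A (this seat, p856277): `fixedIdeleSplitEquiv`, `archCoord`, `finCoord`, `archCoordC_*`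
import Summits.HodgeConjecture.HodgeConjecture.Theorems.K2E5QuatFinNrdSurjective        -- ★ (23) ED.2 (K2E5-p08, p856025): `range_quatFinNrd_eq_fixedFinAdelicUnits`; brings `coe_quatFinNrd_quatFinPart`, ★ #3m ED.2 `quatAdelicProdEquiv`
import Summits.HodgeConjecture.HodgeConjecture.Theorems.K2E5QuatArchPlaces             -- ★ (K2E5-p04, p856035): `quatArchAt`, `quatArchPiEquiv`; brings ★ `K2E5QuatArchLocalDefs` (`quatArchNrd`, `ofReal_quatArchNrd`)
import Summits.HodgeConjecture.HodgeConjecture.Theorems.K2E5QuatAdelicMeasureDefs      -- ★ #3k (K2E5-p12): `quatNrdImage`, `mem_quatNrdImage_iff`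
import HarnessLib

/-!
# K2_E5 road (h413 = stmt-HodgeConjecture-24833), unit G organ (O6), FILE A′: `Nrd` splits as `(Nrd_∞, Nrd_f)` and the image torus splits accordingly

Cell `pub/hodgecm-mathlib` (D-0151), Track B; dealer K2E5-plan (g2), SWEEP #15 (2026-09-04T00:44:41Z) «(O6) ↦ K2E5-p10 (g2)» for K2E5-p17 (g2)'s G13 head
(REPORT-FIRST (31), (O6 = 31c): «compatible with `quatAdelicNrd = (Nrd_∞ × quatFinNrd) ∘ quatAdelicProdEquiv`; `quatNrdImage(h) ↔ im_∞(h) × im_f` (`im_f` = ALL of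
`fixedFinAdelicUnits`, ★ p856025)»).  Sibling of ★ FILE A `K2E5FixedIdeleBaseSplitting` (`fixedIdeleSplitEquiv L : (W → ℝˣ) × ↥(fixedFinAdelicUnits L) ≃ₜ* ↥(fixedAdelicUnits L)`,
`W := {w : InfinitePlace L // IsComplex w}`); FILE B `K2E5FixedIdeleBaseComparison` carries the measures.

* §1 **`Nrd` SPLITS**: `archCoordC_quatAdelicNrd : archCoordC (Nrd x) w = (Nrd_w (x_{∞,w}) : ℂ)`, `archCoord_quatAdelicNrd`, `finCoord_quatAdelicNrd` and
  **`fixedIdeleSplitEquiv_nrd : fixedIdeleSplitEquiv L (fun w => quatArchNrd L h w hdet (quatArchAt L h w (quatArchPart L h x)), ⟨quatFinNrd L h (quatFinPart L h x), _⟩) = ⟨quatAdelicNrd L h x, _⟩`**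
  (`det` commutes with `𝔸_L → L_∞ → L ⊗ ℝ → ℂ`, Mathlib `RingHom.map_det`; ★ `coe_quatFinNrd_quatFinPart`) — `Nrd_∞` is spelled with ★ names only ((O3)'s `quatArchNrdPi` is
  definitionally `fun w => quatArchNrd w ∘ quatArchAt w`).
* §2 **THE IMAGE SPLITS**: `archNrdImage L h hdet := Subgroup.pi univ (fun w => (quatArchNrd L h w hdet).range)` (= `im_∞(h)`), and
  **`mem_quatNrdImage_iff_archCoord_mem : u ∈ quatNrdImage L h ↔ archCoord L u ∈ archNrdImage L h hdet`** — the finite coordinate imposes NO condition (`Nrd_f` is ONTO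
  `(𝔸_{L⁺,f})^×`, ★ `range_quatFinNrd_eq_fixedFinAdelicUnits`), and the arch places are independent (★ `quatArchPiEquiv`, ★ `quatAdelicProdEquiv`);
  **`quatNrdImageSplitEquiv L h hHa hdet : ↥(archNrdImage L h hdet) × ↥(fixedFinAdelicUnits L) ≃ₜ* ↥(quatNrdImage L h)`** (the restriction of `fixedIdeleSplitEquiv`; identity on idèles,
  `coe_coe_quatNrdImageSplitEquiv_apply`).

[cite: VignerasLNM800, Ch. III §1–§2 (n_A = (n_v)_v; n(H_A^×) = {x ∈ K_A^× : x_v > 0 at the ramified real places})] [cite: BorelJacquet1979, §4.1] [cite: CasselsFrohlichANT1967, Ch. II §14]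

HONEST LABEL: HC_CM is proved only modulo the 7 printed citations (2 remaining named inputs: hLiu418 = stmt-HodgeConjecture-24832,
h413 = stmt-HodgeConjecture-24833) until rung 0 closes; this file is a `--supports stmt-HodgeConjecture-24833 --as helper` defs leaf (definitions + structural lemmas;
no `instance`, no `notation`, no `sorry`, no `def … : Prop`) and retires nothing by itself.
-/

set_option autoImplicit false
set_option linter.dupNamespace false   -- `Summit.HodgeConjecture.HodgeConjecture.…` (D-0017 nested layout; lakefile exemption for Summits)

noncomputable section

namespace Summit.HodgeConjecture.HodgeConjecture.Cruxes.H413.K2E5QuatNrdImageSplitting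

open NumberField NumberField.InfinitePlace NumberField.mixedEmbedding IsDedekindDomain Topology
open Literature.NumberTheory.Automorphic Literature.NumberTheory.Automorphic.UnitaryGroup
open Summit.HodgeConjecture.HodgeConjecture.Cruxes.H413.K2E5QuatAdelicMatrixModel
open Summit.HodgeConjecture.HodgeConjecture.Cruxes.H413.K2E5QuatAdelicNrd
open Summit.HodgeConjecture.HodgeConjecture.Cruxes.H413.K2E5QuatAdelicMeasure
open Summit.HodgeConjecture.HodgeConjecture.Cruxes.H413.K2E5QuatAdelicRestrictedProduct
open Summit.HodgeConjecture.HodgeConjecture.Cruxes.H413.K2E5QuatAdelicProdDecomposition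
open Summit.HodgeConjecture.HodgeConjecture.Cruxes.H413.K2E5QuatFinNrd
open Summit.HodgeConjecture.HodgeConjecture.Cruxes.H413.K2E5QuatFinNrdSurjective
open Summit.HodgeConjecture.HodgeConjecture.Cruxes.H413.K2E5QuatArchLocal
open Summit.HodgeConjecture.HodgeConjecture.Cruxes.H413.K2E5QuatArchPlaces
open Summit.HodgeConjecture.HodgeConjecture.Cruxes.H413.K2E5FixedIdeleBaseSplitting
open scoped Matrix MatrixGroups ComplexConjugate

variable (L : Type) [Field L] [NumberField L] [IsCMField L]

/-! ## §1 The reduced norm splits as `(Nrd_∞, Nrd_f)` -/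

variable (Ha : Matrix (Fin 2) (Fin 2) L) (hdet : Ha.det ≠ 0)

/-- **The archimedean coordinates of `Nrd x` are the local reduced norms**: `archCoordC (Nrd x) w = det (x_{∞,w}) = (Nrd_w (x_{∞,w}) : ℂ)` with
`x_{∞,w} = quatArchAt w (quatArchPart x)` (`det` commutes with the ring maps `𝔸_L → L_∞ → L ⊗ ℝ → ℂ`, Mathlib `RingHom.map_det`; ★ `ofReal_quatArchNrd`).
[cite: VignerasLNM800, Ch. III §1 (n_A = (n_v))] [cite: BorelJacquet1979, §4.1] -/
theorem archCoordC_quatAdelicNrd (x : ↥(quatAdelicUnits L Ha)) (w : {w : InfinitePlace L // IsComplex w}) :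
    archCoordC L (quatAdelicNrd L Ha x) w = ((((quatArchNrd L Ha w hdet (quatArchAt L Ha w (quatArchPart L Ha x)) : ℝˣ) : ℝ) : ℂ)) := by
  rw [ofReal_quatArchNrd, archCoordC_def, coe_quatAdelicNrd]
  change ((evalC L w).comp ((InfiniteAdeleRing.ringEquiv_mixedSpace L).toRingHom.comp (adeleFst L)))
      (((x : GL (Fin 2) (AdeleRing (𝓞 L) L)) : Matrix (Fin 2) (Fin 2) (AdeleRing (𝓞 L) L)).det) = _
  rw [RingHom.map_det]
  congr 1

/-- The real archimedean coordinates of `Nrd x`: `archCoord (Nrd x) w = Nrd_w (x_{∞,w})`. [cite: VignerasLNM800, Ch. III §1] -/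
theorem archCoord_quatAdelicNrd (x : ↥(quatAdelicUnits L Ha)) (w : {w : InfinitePlace L // IsComplex w}) :
    archCoord L ⟨quatAdelicNrd L Ha x, quatAdelicNrd_mem_fixedAdelicUnits L Ha hdet x⟩ w = quatArchNrd L Ha w hdet (quatArchAt L Ha w (quatArchPart L Ha x)) := by
  refine Units.ext ?_
  rw [coe_archCoord]
  change (archCoordC L (quatAdelicNrd L Ha x) w).re = _
  rw [archCoordC_quatAdelicNrd L Ha hdet, Complex.ofReal_re]

include hdet in
/-- `Nrd_f (x_f) ∈ (𝔸_{L⁺,f})^×` (the finite coordinate of the fixed idèle `Nrd x`, ★ `coe_quatFinNrd_quatFinPart`). [cite: VignerasLNM800, Ch. III §1] -/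
theorem quatFinNrd_quatFinPart_mem (x : ↥(quatAdelicUnits L Ha)) : quatFinNrd L Ha (quatFinPart L Ha x) ∈ fixedFinAdelicUnits L := by
  have h := units_map_snd_mem_fixedFinAdelicUnits L ⟨quatAdelicNrd L Ha x, quatAdelicNrd_mem_fixedAdelicUnits L Ha hdet x⟩
  have he : Units.map (adeleSnd L).toMonoidHom (quatAdelicNrd L Ha x) = quatFinNrd L Ha (quatFinPart L Ha x) :=
    Units.ext (coe_quatFinNrd_quatFinPart L Ha x).symm
  rw [he] at h
  exact h

/-- The finite coordinate of `Nrd x` is `Nrd_f (x_f)` (★ `coe_quatFinNrd_quatFinPart`). [cite: VignerasLNM800, Ch. III §1] [cite: BorelJacquet1979, §4.1] -/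
theorem finCoord_quatAdelicNrd (x : ↥(quatAdelicUnits L Ha)) :
    finCoord L ⟨quatAdelicNrd L Ha x, quatAdelicNrd_mem_fixedAdelicUnits L Ha hdet x⟩ =
      ⟨quatFinNrd L Ha (quatFinPart L Ha x), quatFinNrd_quatFinPart_mem L Ha hdet x⟩ :=
  Subtype.ext (Units.ext (coe_quatFinNrd_quatFinPart L Ha x).symm)

/-- **COMPATIBILITY OF THE SPLITTING WITH `Nrd`**: `fixedIdeleSplitEquiv (Nrd_∞ x_∞, Nrd_f x_f) = Nrd x` — the global reduced norm of `x ∈ (D_h ⊗ 𝔸)^×` splits as the family of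
archimedean local reduced norms `(Nrd_w (x_{∞,w}))_w` (★ `quatArchNrd ∘ quatArchAt ∘ quatArchPart`) and the finite reduced norm `Nrd_f (x_f)` (★ `quatFinNrd ∘ quatFinPart`).
[cite: VignerasLNM800, Ch. III §1 (n_A = (n_v)_v)] [cite: BorelJacquet1979, §4.1] -/
theorem fixedIdeleSplitEquiv_nrd (x : ↥(quatAdelicUnits L Ha)) :
    fixedIdeleSplitEquiv L (fun w => quatArchNrd L Ha w hdet (quatArchAt L Ha w (quatArchPart L Ha x)),
        ⟨quatFinNrd L Ha (quatFinPart L Ha x), quatFinNrd_quatFinPart_mem L Ha hdet x⟩) =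
      ⟨quatAdelicNrd L Ha x, quatAdelicNrd_mem_fixedAdelicUnits L Ha hdet x⟩ := by
  rw [← (fixedIdeleSplitEquiv L).apply_symm_apply ⟨quatAdelicNrd L Ha x, quatAdelicNrd_mem_fixedAdelicUnits L Ha hdet x⟩]
  congr 1
  refine Prod.ext (funext fun w => ?_) ?_
  · rw [fixedIdeleSplitEquiv_symm_apply_fst, archCoord_quatAdelicNrd]
  · rw [fixedIdeleSplitEquiv_symm_apply_snd, finCoord_quatAdelicNrd L Ha hdet]

/-- The same read on the inverse: `(fixedIdeleSplitEquiv)⁻¹ (Nrd x) = (Nrd_∞ x_∞, Nrd_f x_f)`. [cite: VignerasLNM800, Ch. III §1] -/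
theorem fixedIdeleSplitEquiv_symm_nrd (x : ↥(quatAdelicUnits L Ha)) :
    (fixedIdeleSplitEquiv L).symm ⟨quatAdelicNrd L Ha x, quatAdelicNrd_mem_fixedAdelicUnits L Ha hdet x⟩ =
      (fun w => quatArchNrd L Ha w hdet (quatArchAt L Ha w (quatArchPart L Ha x)),
        ⟨quatFinNrd L Ha (quatFinPart L Ha x), quatFinNrd_quatFinPart_mem L Ha hdet x⟩) := by
  rw [← fixedIdeleSplitEquiv_nrd L Ha hdet x, ContinuousMulEquiv.symm_apply_apply]

/-! ## §2 The image torus splits: `Nrd((D_h ⊗ 𝔸)^×) ≃ (Π_w Nrd_w(D_{h,w}^×)) × (𝔸_{L⁺,f})^×` -/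

/-- **`im_∞(h) := Π_w Nrd_w(D_{h,w}^×) ≤ (W → ℝˣ)`** — the archimedean image of the reduced norm, place by place (★ `quatArchNrd w`; `ℝ_{>0}` at a definite place, `ℝ^×` at an
indefinite one, ★ `K2E5QuatArchTrdGram`). [cite: VignerasLNM800, Ch. III §2 (n(H_A^×))] -/
def archNrdImage : Subgroup ({w : InfinitePlace L // IsComplex w} → ℝˣ) :=
  Subgroup.pi Set.univ fun w => (quatArchNrd L Ha w hdet).range

omit [NumberField L] [IsCMField L] in
/-- Membership in `im_∞(h)`: every coordinate is a local reduced norm. [cite: VignerasLNM800, Ch. III §2] -/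
theorem mem_archNrdImage_iff (r : {w : InfinitePlace L // IsComplex w} → ℝˣ) :
    r ∈ archNrdImage L Ha hdet ↔ ∀ w, ∃ g : ↥(quatArchLocalUnits L Ha w), quatArchNrd L Ha w hdet g = r w := by
  simp only [archNrdImage, Subgroup.mem_pi, Set.mem_univ, true_implies, MonoidHom.mem_range]

/-- `Nrd_∞ x ∈ im_∞(h)`. [cite: VignerasLNM800, Ch. III §2] -/
theorem archNrd_mem_archNrdImage (x : ↥(quatAdelicUnits L Ha)) :
    (fun w => quatArchNrd L Ha w hdet (quatArchAt L Ha w (quatArchPart L Ha x))) ∈ archNrdImage L Ha hdet :=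
  (mem_archNrdImage_iff L Ha hdet _).2 fun _ => ⟨_, rfl⟩

/-- **A reduced norm has archimedean coordinates in `im_∞(h)`**: `u = Nrd x ⇒ archCoord u ∈ im_∞(h)`. [cite: VignerasLNM800, Ch. III §2] -/
theorem archCoord_mem_archNrdImage_of_mem {u : ↥(fixedAdelicUnits L)} (hu : u ∈ quatNrdImage L Ha) : archCoord L u ∈ archNrdImage L Ha hdet := by
  obtain ⟨x, hx⟩ := (mem_quatNrdImage_iff L Ha u).1 hu
  have hux : u = ⟨quatAdelicNrd L Ha x, quatAdelicNrd_mem_fixedAdelicUnits L Ha hdet x⟩ := Subtype.ext hx.symm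
  rw [hux, (funext fun w => archCoord_quatAdelicNrd L Ha hdet x w : archCoord L ⟨quatAdelicNrd L Ha x, _⟩ = _)]
  exact archNrd_mem_archNrdImage L Ha hdet x

variable (hHa : (Ha.map (cmConjRingHom L)).transpose = Ha)

include hHa in
/-- **Conversely**: a fixed idèle whose archimedean coordinates lie in `im_∞(h)` IS a reduced norm — its finite coordinate is automatically one (`Nrd_f` is onto `(𝔸_{L⁺,f})^×`,
★ `range_quatFinNrd_eq_fixedFinAdelicUnits`), and an adelic unit with prescribed archimedean components and finite part exists (★ `quatArchPiEquiv`, ★ `quatAdelicProdEquiv`).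
[cite: VignerasLNM800, Ch. III §2] [cite: BorelJacquet1979, §4.1] -/
theorem mem_quatNrdImage_of_archCoord_mem {u : ↥(fixedAdelicUnits L)} (hu : archCoord L u ∈ archNrdImage L Ha hdet) : u ∈ quatNrdImage L Ha := by
  classical
  -- arch witnesses, place by place; a finite witness
  choose g hg using (mem_archNrdImage_iff L Ha hdet _).1 hu
  have hfin : ((finCoord L u : ↥(fixedFinAdelicUnits L)) : (FiniteAdeleRing (𝓞 L) L)ˣ) ∈ (quatFinNrd L Ha).range := by
    rw [range_quatFinNrd_eq_fixedFinAdelicUnits L Ha hHa hdet]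
    exact (finCoord L u).2
  obtain ⟨y, hy⟩ := MonoidHom.mem_range.1 hfin
  -- the adelic unit with these components
  set x : ↥(quatAdelicUnits L Ha) := (quatAdelicProdEquiv L Ha).symm ((quatArchPiEquiv L Ha).symm g, y) with hxdef
  have hparts : quatAdelicProdEquiv L Ha x = ((quatArchPiEquiv L Ha).symm g, y) := by rw [hxdef, ContinuousMulEquiv.apply_symm_apply]
  have harch : quatArchPart L Ha x = (quatArchPiEquiv L Ha).symm g := by
    have h := congrArg Prod.fst hparts
    rwa [quatAdelicProdEquiv_apply] at h
  have hfinpart : quatFinPart L Ha x = y := by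
    have h := congrArg Prod.snd hparts
    rwa [quatAdelicProdEquiv_apply] at h
  have hat : ∀ w, quatArchAt L Ha w (quatArchPart L Ha x) = g w := fun w => by
    rw [harch]
    exact congrFun ((quatArchPiEquiv L Ha).apply_symm_apply g) w
  refine (mem_quatNrdImage_iff L Ha u).2 ⟨x, ?_⟩
  -- compare through the splitting
  have key : (fixedIdeleSplitEquiv L).symm ⟨quatAdelicNrd L Ha x, quatAdelicNrd_mem_fixedAdelicUnits L Ha hdet x⟩ = (fixedIdeleSplitEquiv L).symm u := by
    rw [fixedIdeleSplitEquiv_symm_nrd L Ha hdet]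
    refine Prod.ext (funext fun w => ?_) (Subtype.ext ?_)
    · change quatArchNrd L Ha w hdet (quatArchAt L Ha w (quatArchPart L Ha x)) = ((fixedIdeleSplitEquiv L).symm u).1 w
      rw [fixedIdeleSplitEquiv_symm_apply_fst, hat w, hg w]
    · change (quatFinNrd L Ha (quatFinPart L Ha x) : (FiniteAdeleRing (𝓞 L) L)ˣ) = ((((fixedIdeleSplitEquiv L).symm u).2 : ↥(fixedFinAdelicUnits L)) : (FiniteAdeleRing (𝓞 L) L)ˣ)
      rw [fixedIdeleSplitEquiv_symm_apply_snd, hfinpart, hy]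
  have := congrArg Subtype.val ((fixedIdeleSplitEquiv L).symm.injective key)
  exact this

include hHa in
/-- **THE IMAGE CRITERION**: `u ∈ Nrd((D_h ⊗ 𝔸)^×) ↔ archCoord u ∈ im_∞(h)` (no condition at the finite places). [cite: VignerasLNM800, Ch. III §2 (Thm. 2.1: n(H_A^×))] -/
theorem mem_quatNrdImage_iff_archCoord_mem (u : ↥(fixedAdelicUnits L)) : u ∈ quatNrdImage L Ha ↔ archCoord L u ∈ archNrdImage L Ha hdet :=
  ⟨archCoord_mem_archNrdImage_of_mem L Ha hdet, mem_quatNrdImage_of_archCoord_mem L Ha hdet hHa⟩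

include hHa in
/-- The splitting carries `im_∞(h) × (𝔸_{L⁺,f})^×` INTO the image torus. [cite: VignerasLNM800, Ch. III §2] -/
theorem fixedIdeleSplitEquiv_mem_quatNrdImage (a : ↥(archNrdImage L Ha hdet)) (t : ↥(fixedFinAdelicUnits L)) :
    fixedIdeleSplitEquiv L ((a : {w : InfinitePlace L // IsComplex w} → ℝˣ), t) ∈ quatNrdImage L Ha := by
  refine mem_quatNrdImage_of_archCoord_mem L Ha hdet hHa ?_
  rw [← fixedIdeleSplitEquiv_symm_apply_fst, ContinuousMulEquiv.symm_apply_apply]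
  exact a.2

/-- **`quatNrdImageSplitEquiv : im_∞(h) × (𝔸_{L⁺,f})^× ≃* Nrd((D_h ⊗ 𝔸)^×)`** — the restriction of ★ `fixedIdeleSplitEquiv` to the image torus (identity on idèles).
[cite: VignerasLNM800, Ch. III §2] [cite: BorelJacquet1979, §4.1] -/
def quatNrdImageSplitMulEquiv : (↥(archNrdImage L Ha hdet) × ↥(fixedFinAdelicUnits L)) ≃* ↥(quatNrdImage L Ha) where
  toFun p := ⟨fixedIdeleSplitEquiv L ((p.1 : {w : InfinitePlace L // IsComplex w} → ℝˣ), p.2), fixedIdeleSplitEquiv_mem_quatNrdImage L Ha hdet hHa p.1 p.2⟩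
  invFun u := (⟨archCoord L (u : ↥(fixedAdelicUnits L)), archCoord_mem_archNrdImage_of_mem L Ha hdet u.2⟩, finCoord L (u : ↥(fixedAdelicUnits L)))
  left_inv p := by
    refine Prod.ext (Subtype.ext ?_) ?_
    · change archCoord L (fixedIdeleSplitEquiv L ((p.1 : {w : InfinitePlace L // IsComplex w} → ℝˣ), p.2)) = (p.1 : {w : InfinitePlace L // IsComplex w} → ℝˣ)
      rw [← fixedIdeleSplitEquiv_symm_apply_fst, ContinuousMulEquiv.symm_apply_apply]
    · change finCoord L (fixedIdeleSplitEquiv L ((p.1 : {w : InfinitePlace L // IsComplex w} → ℝˣ), p.2)) = p.2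
      rw [← fixedIdeleSplitEquiv_symm_apply_snd, ContinuousMulEquiv.symm_apply_apply]
  right_inv u := by
    refine Subtype.ext ?_
    change fixedIdeleSplitEquiv L (archCoord L (u : ↥(fixedAdelicUnits L)), finCoord L (u : ↥(fixedAdelicUnits L))) = (u : ↥(fixedAdelicUnits L))
    rw [← fixedIdeleSplitEquiv_symm_apply_fst, ← fixedIdeleSplitEquiv_symm_apply_snd, Prod.mk.eta, ContinuousMulEquiv.apply_symm_apply]
  map_mul' p q := Subtype.ext (by
    change fixedIdeleSplitEquiv L (((p * q).1 : {w : InfinitePlace L // IsComplex w} → ℝˣ), (p * q).2) =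
      fixedIdeleSplitEquiv L ((p.1 : {w : InfinitePlace L // IsComplex w} → ℝˣ), p.2) * fixedIdeleSplitEquiv L ((q.1 : {w : InfinitePlace L // IsComplex w} → ℝˣ), q.2)
    rw [← map_mul]
    rfl)

/-- Underlying idèle of `quatNrdImageSplitMulEquiv (a, t)`: `ideleOfArchFin (a, t)`. [folklore] -/
@[simp] theorem coe_coe_quatNrdImageSplitMulEquiv_apply (p : ↥(archNrdImage L Ha hdet) × ↥(fixedFinAdelicUnits L)) :
    (((quatNrdImageSplitMulEquiv L Ha hdet hHa p : ↥(quatNrdImage L Ha)) : ↥(fixedAdelicUnits L)) : (AdeleRing (𝓞 L) L)ˣ) =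
      ideleOfArchFin L ((p.1 : {w : InfinitePlace L // IsComplex w} → ℝˣ), (p.2 : (FiniteAdeleRing (𝓞 L) L)ˣ)) :=
  rfl

/-- As fixed idèles: `quatNrdImageSplitMulEquiv (a, t) = fixedIdeleSplitEquiv (a, t)`. [folklore] -/
@[simp] theorem coe_quatNrdImageSplitMulEquiv_apply (p : ↥(archNrdImage L Ha hdet) × ↥(fixedFinAdelicUnits L)) :
    ((quatNrdImageSplitMulEquiv L Ha hdet hHa p : ↥(quatNrdImage L Ha)) : ↥(fixedAdelicUnits L)) = fixedIdeleSplitEquiv L ((p.1 : {w : InfinitePlace L // IsComplex w} → ℝˣ), p.2) :=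
  rfl

/-- `quatNrdImageSplitMulEquiv` is continuous. [folklore] -/
theorem continuous_quatNrdImageSplitMulEquiv : Continuous (quatNrdImageSplitMulEquiv L Ha hdet hHa) :=
  continuous_induced_rng.2 ((fixedIdeleSplitEquiv L).continuous.comp ((continuous_subtype_val.comp continuous_fst).prodMk continuous_snd))

/-- The inverse of `quatNrdImageSplitMulEquiv` is continuous. [folklore] -/
theorem continuous_quatNrdImageSplitMulEquiv_symm : Continuous (quatNrdImageSplitMulEquiv L Ha hdet hHa).symm :=
  (((K2E5FixedIdeleBaseSplitting.continuous_archCoord L).comp continuous_subtype_val).subtype_mk _).prodMk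
    ((continuous_finCoord L).comp continuous_subtype_val)

/-- **`quatNrdImageSplitEquiv L h hHa hdet : im_∞(h) × (𝔸_{L⁺,f})^× ≃ₜ* Nrd((D_h ⊗ 𝔸)^×)`** as topological groups — the restriction of ★ `fixedIdeleSplitEquiv` to the image torus
`quatNrdImage L h` (★ #3k), along which FILE B compares `quatNrdImageMeasure` with a product measure. [cite: VignerasLNM800, Ch. III §2] [cite: BorelJacquet1979, §4.1] -/
def quatNrdImageSplitEquiv : (↥(archNrdImage L Ha hdet) × ↥(fixedFinAdelicUnits L)) ≃ₜ* ↥(quatNrdImage L Ha) :=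
  { quatNrdImageSplitMulEquiv L Ha hdet hHa with
    continuous_toFun := continuous_quatNrdImageSplitMulEquiv L Ha hdet hHa
    continuous_invFun := continuous_quatNrdImageSplitMulEquiv_symm L Ha hdet hHa }

/-- Underlying fixed idèle of `quatNrdImageSplitEquiv (a, t)`. [folklore] -/
@[simp] theorem coe_quatNrdImageSplitEquiv_apply (p : ↥(archNrdImage L Ha hdet) × ↥(fixedFinAdelicUnits L)) :
    ((quatNrdImageSplitEquiv L Ha hdet hHa p : ↥(quatNrdImage L Ha)) : ↥(fixedAdelicUnits L)) = fixedIdeleSplitEquiv L ((p.1 : {w : InfinitePlace L // IsComplex w} → ℝˣ), p.2) :=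
  rfl

/-- The inverse: `(quatNrdImageSplitEquiv)⁻¹ u = (archCoord u, finCoord u)`. [folklore] -/
theorem quatNrdImageSplitEquiv_symm_apply (u : ↥(quatNrdImage L Ha)) :
    (quatNrdImageSplitEquiv L Ha hdet hHa).symm u =
      (⟨archCoord L (u : ↥(fixedAdelicUnits L)), archCoord_mem_archNrdImage_of_mem L Ha hdet u.2⟩, finCoord L (u : ↥(fixedAdelicUnits L))) :=
  rfl

/-- **COMPATIBILITY on the image torus**: `quatNrdImageSplitEquiv (Nrd_∞ x, Nrd_f x_f) = quatAdelicNrdToImage x` (★ #3k's ranged reduced norm). [cite: VignerasLNM800, Ch. III §2] -/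
theorem quatNrdImageSplitEquiv_nrd (x : ↥(quatAdelicUnits L Ha)) :
    quatNrdImageSplitEquiv L Ha hdet hHa (⟨fun w => quatArchNrd L Ha w hdet (quatArchAt L Ha w (quatArchPart L Ha x)), archNrd_mem_archNrdImage L Ha hdet x⟩,
        ⟨quatFinNrd L Ha (quatFinPart L Ha x), quatFinNrd_quatFinPart_mem L Ha hdet x⟩) = quatAdelicNrdToImage L Ha hdet x :=
  Subtype.ext (by rw [coe_quatNrdImageSplitEquiv_apply, fixedIdeleSplitEquiv_nrd]; rfl)

end Summit.HodgeConjecture.HodgeConjecture.Cruxes.H413.K2E5QuatNrdImageSplitting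

end
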